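import Literature.MathematicalPhysics.QuantumFieldTheory.Balaban1983to89.T4PersistenceDictionary

/-!
# `Balaban1983to89.T4BankedInduction` — THE BANKED INDUCTION (1.80⁺) OVER THE (ID) GENEALOGY LEDGER: print's
component bookkeeping (1.83)/(1.85)–(1.88) of [Balaban1989LargeFieldII] re-run AS ARITHMETIC with the slack KEPT, and
its exponentiated form in the records currency of the NE7b count carrier (cell `pub-balaban`, node U5c / spine estimate
NE7b, COUNT member P1; journal CLAIM T4-U5c.E-NE7b-BANKED-K* 2026-08-19T14:08:55Z, unit `b2b-balaban-t4-ne7b-p1` gen 8,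
the lineage of `…T4PersistentHistoryCount` / `…T4PersistenceDictionary` / `…T4LiveStructureGas`; companion record
`t4/T4-EST-NE7b-P1.md` v1.8 → v1.9; imports `…T4PersistenceDictionary` ONLY and modifies nothing; **v1.1** (gen 9, journal CLAIM
T4-U5c.E-NE7b-PRINTEDSHAPE-K*): the ADMISSIBILITY GUARD asked by cross-read C-pv20-57 (objection O1) + its DOCFIX D1 — paragraph
VERSION below)

HONEST FRAMING (cell `pub-balaban`, T4-DAG PAGE 1).  The cell's T4 target is the existence AND uniqueness of the
`ε → 0` limit of Bałaban's unit-scale block-averaged expectations on a FIXED finite four-torus — rung (B)+1, strictly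
beyond ultraviolet stability ([Balaban1989LargeFieldII] Thm 1 p. 355, [Balaban1988Convergent] Cor. 3 p. 264); it is NOT
infinite volume, NOT a mass gap, NOT the Clay problem, and it is CONDITIONAL on BetaPertH, (B), (B^μ), which stay
binders of the consumer and are used nowhere in this module.  This module is [folklore] finite combinatorics and real
arithmetic over ABSTRACT cost / credit data (zero `sorry`, zero cite-tagged hypothesis, no `def … : Prop` fact of
Bałaban's).  B16 = [Balaban1989LargeFieldII] is a manuscript UNDER AUDIT: the page pointers and the sentences quoted
below LOCATE which printed case each binder models (they repeat quotations certified in `t4/T4-XREAD-NE7b-READING.md`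
v1.1 and `t4/T4-XREAD-U5c.md` (Q12)–(Q15)); they are never used as establishing a disputed step.  Value = kernel
bookkeeping around a located gap; NOT an estimate, NOT NE7b, NOT summit progress.

WHERE THIS SITS.  Under RULING R-GD-1 (`t4/T4-REF-U5.md` §10) the U5c weight slot is discharged through the GLOBAL
DENOMINATOR typing; the count member's carrier (`…T4LiveStructureGas.exists_relWeightBound_of_recordsGas`, composed with
the renewal member's `Regeneration` reading in `…T4LiveGasToTerms` §4) needs from the analysis ONE binder in ABSOLUTE
currency: the per-live-structure price majorant `hy : y ≤ ρ_b·e^{−κ₁W_b}·∏_{e∈Q}(e^{−κ₁W_e}·η_e)` (records currency: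
root birth `b`, record `Q` = the other events of the structure's genealogy, `…T4PersistenceDictionary.Gen.mem_records`).
The referee's docket for it is (G3) = R1 + R3′ + (ID) (§10.2 (c)), where R1 is the cell's «BANKED INDUCTION (1.80⁺)»
(`t4/T4-EST-U5c.md` §3 (R1), graded there «modification of B16's printed proof; NEW as a statement»): B16 proves
«κ_j(Z) ≥ Σ_{n=j+1}^{j+K} O(1)M^dR_n^{d+1}d′_n(S^{n−j}(Z)). (1.80)» (p. 384) by an induction over steps and, within a
merger step, over a maximal tree of the merged domains, and its last inequality «≤ κ_{j+1}(Z) − 2(1 + β₀)^{−1}p₀(g_{j+1})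
+ O(1)3(100M)^dR^{d+2}_{j+1} ≤ κ_{j+1}(Z), (1.88) for p₀ large and γ small enough.» (p. 387) DISCARDS the slack; R1
keeps a fixed part `c_b·p₀` of it per event «by the SAME induction».  THE POINT OF THIS MODULE: R1's content splits into
(i) print's per-case INPUTS — four window-local inequalities, each a located sentence — and (ii) the INDUCTION along the
merger tree; and (ii) is pure arithmetic over the (ID) ledger `Gen` (born / renew / merge), proved here once and for all
for abstract data.  What remains of R1 for the instantiating seat is (i), as four NAMED binders (the fields of
`Banking`), each an explicit (B)-type conditional to be read off the printed page — nothing minted here is a fact.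

THE LEDGER (§1) over a genealogy `G : Gen ε` with event windows `W : ε → ℕ`:
* `life W G = Ico rootStep reach` — the steps at which the structure is pending (exclusive reach, the dictionary's
  convention; print states upper bounds «K ≤ …» for the index, booked as the reach);
* `lifeCost W cost G = Σ_{n ∈ life} cost G n` for an abstract per-step CONTROL COST `cost : Gen ε → ℕ → ℝ` (print: the
  summand «O(1)M^dR_n^{d+1}d′_n(S^{n−j}(Z))» of (1.80) p. 384 for the structure's domain at step `n`; the instantiating
  seat defines it from the geometry and proves the four binders);
* `credits credit G = Σ_{events} credit e` — the RAW printed credits (print: a birth's full (1.79) exponent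
  «exp(−½γ₀A₁²p₀²(g_j)(d′_j(Z_j^{(i)}) + 1) − 2p₀(g_j))» p. 381/383, a renewal's «new factor exp(−p₀(g_j))» p. 386, a merger
  `0` — it has no factor of its own);
* `banks bank G = Σ_{events} bank e` — the slack RETAINED per event (the count carrier wants `bank e = κ₁·W e + E e`);
* `reserve : ε → ℝ` — the part of a birth credit set aside for a later absorption: print writes «the factor connected with
  Z in the form exp(−κ_j(Z) − 2p₀(g_{j(Z)}))» (p. 384) with `j(Z)` «the index of a first large field region contained in
  Z»; at a merger «The index j(Z) is equal to one of the indices j(X), j(Y), hence 2p₀(g_{j(X)}) + 2p₀(g_{j(Y)}) −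
  2p₀(g_{j(Z)}) ≥ 2(1 + β₀)^{−1}p₀(g_{j+1}).» (p. 386) — the ROOT keeps its reserve, the ABSORBED partner's root releases it
  as the surplus of (1.87): `Gen.root` / `absorbed` (§1).

THE FOUR BINDERS (§2, `structure Banking adm W …`; each quantified over ADMISSIBLE (`adm`, v1.1) and well-formed (`Gen.WF`)
arguments):
* `born` — a bare region pays its own epoch and keeps bank + reserve: `Σ_{Ico j (j + W b)} cost (born b j) + bank b +
  reserve b ≤ credit b` (print: (1.81)/(1.82) p. 385, «¼γ₀(14)^{−d}A₁²p₀²(g₁) ≥ O(1)2(64)^dM^dL^{d+1}R₁^{d+2}. This condition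
  is satisfied for p₀ large, and g₁ sufficiently small.»);
* `renew_past` + `renew` — the renewed component IS the old one up to the readiness step `h` (same domain, same costs),
  and the fresh factor pays the new window and keeps the bank: `Σ_{Ico (h+1) (h+1+W e)} cost (renew G e h) + bank e ≤
  credit e` (print p. 386 ll. 1–3: «We define κ_{j+1}(Z) = p₀(g_j) − O(1)M^dR_{j+1}^{d+1}d′_{j+1}(Z). It satisfies (1.80),
  because Z is a small domain, it is contained in a cube of the size 100MR_{j+1}, hence K = R_{j+1} for Z.»);
* `merge_geom` — THE COST SPLIT: the life cost of the merged genealogy is at most the partners' life costs plus an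
  extension `ext X Y e` (print: the first inequality of (1.88) p. 387 «Σ_{n=j+2}^{j+1+K}O(1)M^dR^{d+1}_{j+1}d′_n(S^{n−j−1}(Z))
  ≤ Σ_{n=j+2}^{j+1+K₁+n₁}O(1)M^dR^{d+1}_{j+1}d′_n(S^{n−j−1}(X)) + Σ_{n=j+2}^{j+1+K₂+n₁+R_{j+1}}O(1)M^dR^{d+1}_{j+1}d′_n(S^{n−j−1}(Y))»
  with the absorption «K ≤ K₂ + n₁ + R_{j+1}» p. 387 and «d′_{j+1}(X) + d′_{j+1}(Y) + 2d ≥ d′_{j+1}(Z),» p. 386 — GEOMETRY,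
  the ℤᵈ index model of `…B16Absorption` / `…B16MergeHorizon` is where it is decided);
* `merge_pay` — THE SURPLUS pays the extension and keeps the bank: `ext X Y e + bank e ≤ reserve (absorbed X Y) +
  credit e` (print: (1.87) and the middle members of (1.88), «for p₀ large» — R1 asks it with the p₀-largeness DOUBLED,
  `t4/T4-EST-U5c.md` §3 (R1) «c_b = (1 + β₀)^{−1} when p₀(g_{j+1}) ≥ (1 + β₀)·O(1)3(100M)^dR^{d+2}_{j+1}»).
THE THEOREM (§2) `banked_induction : adm G → G.WF W → lifeCost + banks + reserve root ≤ credits` — structural induction, the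
(1.83)/(1.85)–(1.88) skeleton with the slack kept: a renewal splits the new life at `h + 1` (the past is the old
component's, `renew_past`; the future is the fresh window, `renew`); a merger adds the partners' ledgers, the cost split
and the surplus, and re-books the two roots' reserves as (root kept, absorbed spent).
§3 EXPONENTIATED, in the EXACT shape of the carrier's `hy`: with `bank e = κ₁·W e + E e`,
`e^{−credits}·e^{+lifeCost} ≤ ρ_root·e^{−κ₁W root}·∏_{e ∈ events ∖ {root}} (e^{−κ₁W e}·η_e)`, `ρ_b = e^{−(reserve b + E b)}`,
`η_e = e^{−E e}` (`rawFactor_le_recordPrice`; the record `events.erase root` is the dictionary's, `Gen.mem_records`).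
§4 THE PAY SIDE FROM THE TYPED FLOW, by name: the numeric right-hand sides of `renew` / `merge_pay` / `born` in print's
shapes follow from `…T4PersistentHistoryCount.credit_dominates_window_poly` (typed (2.7) `B14.FlowIneq27`, typed (2.5)
`B14.IsRj`, the exponent conditions and two γ-clauses on `g_K`) and `birthCredit_dominates`: a renewal at readiness `h`
pays at scale `h + 1` out of `p₀(g_h)` (factor `(1+β₀)` of (2.7)), a merger at step `s` pays out of the absorbed root's
`2p₀(g_m)`, `m ≤ s` (the printed `(1+β₀)^{−1}` of the surplus sentence IS (2.7)'s first member), uniformly in `K`.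
§5 NON-VACUITY: the FLAT model (`Banking.flat`: constant per-step cost, every event credited its window, bank and
reserve) inhabits all four binders at once for arbitrary windows (with `adm := fun _ => True`) — its `merge_geom` is exactly
the overlap count: the partners' lives overlap, so the merged life is no longer than the two lives plus the merger window
(`card_life_merge_le`, from `Gen.WF`) — and the theorem is checked numerically on the dictionary's
`G₀ = merge (born 0 0) (born 1 1) 2`.  The inhabitation by PRINT-SHAPED data is the separate leaf `…T4PrintedShapeBanking`.
WHERE THE LEDGER IS STRONGER / WEAKER THAN THE PAGE (flagged; harmless for UPPER bounds).  (S1) [v1.1] the binders are asked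
for every ADMISSIBLE well-formed genealogy, `adm : Gen ε → Prop` being a downward-closed predicate chosen by the instantiating
seat (print runs the induction along the actual history only); v1 asked them for EVERY genealogy, which — cross-read C-pv20-57,
objection O1, kernel-witnessed — forces `bank e ≤ credit e` for every event (from `renew (born b 0) e 0`) and so EXCLUDES
print-shaped data (merger credit `0`, positive bank) for any cost/reserve/ext; `adm := fun _ => True` recovers v1; (S2) a renewal may happen at any pending step `rootStep ≤ h < reach` (print: at readiness), so the
renewed life `Ico rootStep (h+1+W e)` may even be SHORTER than the old one — the theorem only ever bounds above; (S3)
`ext` is free data: print's extension is the `n₁` steps of the absorbed partner beyond its horizon, the `n₁ + R_{j+1}` of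
the other, and the `2d` overheads, bounded by «O(1)3(100M)^dR^{d+2}_{j+1}» — its identification is the consumer's (ID);
(S4) `credit e` of a merger is kept as data (print: `0`; an m1 merger's new region is a separate `born` constituent with
its own credit, exactly as the dictionary books it).  NOT DONE HERE (the wall, as relocated under (GD), census
`t4/T4-EST-NE7b-P1.md` §4): R3′ (the per-live-TERM reading of the operation-level bounds (1.79)/(1.80)/(1.85)–(1.89),
[R]-grade, obligation O-R10 of the t4-ne7b-p2 lineage), (ID) for the realised histories, and the four binders READ OFF
the page for Bałaban's actual costs — R1's arithmetic is no longer among them.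

VERSION v1.1 (gen 9; cross-read C-pv20-57 of v1 p189044: ok-as-tree-artefact ∣ objection O1 ∣ DOCFIX D1).  O1: `Banking` takes
the admissibility predicate `adm : Gen ε → Prop` as its first argument, with the heredity fields `adm_renew` / `adm_merge`,
and every binder is guarded by `adm` of the genealogy it concerns; `lifeCost_renew_le`, `banked_induction`, `banks_le_net`,
`lifeCost_add_banks_le`, `rawFactor_le`, `rawFactor_le_recordPrice` carry the hypothesis `adm G`; `Banking.flat : Banking
(fun _ => True) …`, §4 and §5 are unchanged in content.  D1: three self-phrases lost their guillemets (the §5 sentence above,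
`banks_le_net`, `card_life_merge_le`); no quotation was added.
-/

open Finset

namespace Literature.MathematicalPhysics.QuantumFieldTheory.Balaban1983to89.T4BankedInduction

open Literature.MathematicalPhysics.QuantumFieldTheory.Balaban1983to89
open T4PersistenceDictionary T4PersistentHistoryCount

/-! ## §1 The ledger of a genealogy: life, life cost, raw credits, retained banks, the two roots of a merger -/

section Ledger

variable {ε : Type*}

/-- **THE PENDING LIFE** of a genealogy: the steps `[rootStep, reach)` (birth step included, reach exclusive — the
dictionary's convention, `Gen.reach`). [folklore] -/
def life (W : ε → ℕ) (G : Gen ε) : Finset ℕ := Finset.Ico G.rootStep (G.reach W)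

/-- **THE LIFE COST**: the per-step control costs of the structure summed over its pending life (print: the right side
of (1.80) p. 384, for the whole life rather than for the `K` steps after one event). [folklore] -/
def lifeCost (W : ε → ℕ) (cost : Gen ε → ℕ → ℝ) (G : Gen ε) : ℝ := ∑ n ∈ life W G, cost G n

/-- membership in the life [folklore] -/
theorem mem_life {W : ε → ℕ} {G : Gen ε} {n : ℕ} : n ∈ life W G ↔ G.rootStep ≤ n ∧ n < G.reach W := Finset.mem_Ico

/-- the life cost is nonnegative for nonnegative costs [folklore] -/
theorem lifeCost_nonneg {W : ε → ℕ} {cost : Gen ε → ℕ → ℝ} (hc : ∀ G n, 0 ≤ cost G n) (G : Gen ε) :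
    0 ≤ lifeCost W cost G :=
  Finset.sum_nonneg fun n _ => hc G n

/-- **THE ABSORBED ROOT** of a binary merger: the root birth of the partner whose root is NOT the merged root (ties as in
`Gen.root`: towards the first partner, so the second is absorbed) — print p. 386: «The index j(Z) is equal to one of the
indices j(X), j(Y)»; the other index's reserve `2p₀` is the surplus of (1.87). [folklore] -/
def absorbed (X Y : Gen ε) : ε := if X.rootStep ≤ Y.rootStep then Y.root else X.root

/-- root of a bare birth [folklore] -/
@[simp] theorem root_born (b : ε) (j : ℕ) : (Gen.born b j).root = b := rfl

/-- a renewal keeps the root [folklore] -/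
@[simp] theorem root_renew (G : Gen ε) (e : ε) (h : ℕ) : (Gen.renew G e h).root = G.root := rfl

/-- root of a merger: the earlier partner root (equation) [folklore] -/
theorem root_merge (X Y : Gen ε) (e : ε) :
    (Gen.merge X Y e).root = if X.rootStep ≤ Y.rootStep then X.root else Y.root := rfl

/-- **THE TWO ROOTS OF A MERGER ARE RE-BOOKED AS (KEPT, ABSORBED)**: for any real ledger `r`,
`r (root (merge X Y e)) + r (absorbed X Y) = r (root X) + r (root Y)`. [folklore] -/
theorem reserve_merge (r : ε → ℝ) (X Y : Gen ε) (e : ε) :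
    r (Gen.merge X Y e).root + r (absorbed X Y) = r X.root + r Y.root := by
  rw [root_merge]
  unfold absorbed
  split_ifs <;> ring

variable [DecidableEq ε]

/-- **THE RAW CREDITS** of a genealogy: the printed exponents of all its events, summed. [folklore] -/
def credits (credit : ε → ℝ) (G : Gen ε) : ℝ := ∑ e ∈ G.events, credit e

/-- **THE RETAINED BANKS** of a genealogy: the slack kept per event, summed. [folklore] -/
def banks (bank : ε → ℝ) (G : Gen ε) : ℝ := ∑ e ∈ G.events, bank e

/-- ledger of a bare birth [folklore] -/
@[simp] theorem credits_born (credit : ε → ℝ) (b : ε) (j : ℕ) : credits credit (Gen.born b j) = credit b := by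
  simp [credits]

/-- a renewal by a NEW event adds its credit [folklore] -/
theorem credits_renew (credit : ε → ℝ) {G : Gen ε} {e : ε} (h : ℕ) (he : e ∉ G.events) :
    credits credit (Gen.renew G e h) = credit e + credits credit G := by
  simp [credits, Finset.sum_insert he]

/-- a merger by a NEW event of partners with DISJOINT events adds the three ledgers [folklore] -/
theorem credits_merge (credit : ε → ℝ) {X Y : Gen ε} {e : ε} (heX : e ∉ X.events) (heY : e ∉ Y.events)
    (hXY : Disjoint X.events Y.events) :
    credits credit (Gen.merge X Y e) = credit e + (credits credit X + credits credit Y) := by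
  have he : e ∉ X.events ∪ Y.events := by simp [heX, heY]
  simp [credits, Finset.sum_insert he, Finset.sum_union hXY]

end Ledger

/-! ## §2 The four printed cases as binders, and the banked induction -/

section Induction

variable {ε : Type*} [DecidableEq ε]

/-- **THE BANKING HYPOTHESES** — print's cases of the (1.80) induction as NAMED window-local binders over abstract data
(windows `W`, per-step control cost `cost`, raw credits `credit`, retained banks `bank`, birth reserves `reserve`, merger
extensions `ext`), each to be READ OFF [Balaban1989LargeFieldII] pp. 384–387 by the instantiating seat (header: THE FOUR
BINDERS), and each GUARDED (v1.1, cross-read C-pv20-57 O1) by an ADMISSIBILITY predicate `adm : Gen ε → Prop` on the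
genealogy the binder concerns — downward closed (`adm_renew`, `adm_merge`), otherwise free: the instantiating seat puts
there the discipline of the realised histories (event kinds, placement of events at their steps, renewal at readiness,
cutoff), so that the binders are asked only where print's cases apply; `adm := fun _ => True` is v1.  Nothing here is
asserted about Bałaban's expansion. [folklore] -/
structure Banking (adm : Gen ε → Prop) (W : ε → ℕ) (cost : Gen ε → ℕ → ℝ) (credit bank reserve : ε → ℝ)
    (ext : Gen ε → Gen ε → ε → ℝ) : Prop where
  /-- control costs are nonnegative -/
  cost_nonneg : ∀ G n, 0 ≤ cost G n
  /-- admissibility descends to the renewed component -/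
  adm_renew : ∀ G e h, adm (Gen.renew G e h) → adm G
  /-- admissibility descends to both partners of a merger -/
  adm_merge : ∀ X Y e, adm (Gen.merge X Y e) → adm X ∧ adm Y
  /-- (1.81)/(1.82) p. 385: an admissible bare region's credit pays its own epoch `[j, j + W b)` and keeps bank and
  reserve -/
  born : ∀ b j, adm (Gen.born b j) →
    ∑ n ∈ Finset.Ico j (j + W b), cost (Gen.born b j) n + bank b + reserve b ≤ credit b
  /-- p. 386: the renewed component is the old one up to the readiness step (same domain, no larger cost) -/
  renew_past : ∀ G e h, adm (Gen.renew G e h) → (Gen.renew G e h).WF W → ∀ n, n ≤ h → cost (Gen.renew G e h) n ≤ cost G n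
  /-- p. 386 ll. 1–3 «K = R_{j+1} for Z»: the fresh factor pays the new window `[h+1, h+1+W e)` and keeps the bank -/
  renew : ∀ G e h, adm (Gen.renew G e h) → (Gen.renew G e h).WF W →
    ∑ n ∈ Finset.Ico (h + 1) (h + 1 + W e), cost (Gen.renew G e h) n + bank e ≤ credit e
  /-- (1.88) first inequality + absorption p. 387: the merged life costs at most the two lives plus an extension -/
  merge_geom : ∀ X Y e, adm (Gen.merge X Y e) → (Gen.merge X Y e).WF W →
    lifeCost W cost (Gen.merge X Y e) ≤ lifeCost W cost X + lifeCost W cost Y + ext X Y e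
  /-- (1.87)/(1.88) middle members, «p₀ large» doubled: the absorbed root's reserve pays the extension and the bank -/
  merge_pay : ∀ X Y e, adm (Gen.merge X Y e) → (Gen.merge X Y e).WF W →
    ext X Y e + bank e ≤ reserve (absorbed X Y) + credit e

variable {adm : Gen ε → Prop} {W : ε → ℕ} {cost : Gen ε → ℕ → ℝ} {credit bank reserve : ε → ℝ}
  {ext : Gen ε → Gen ε → ε → ℝ}

/-- **THE RENEWED LIFE SPLITS AT THE RENEWAL**: for a well-formed renewal (`rootStep ≤ h < reach G`) the life cost of
`renew G e h` is at most the OLD life cost of `G` plus the cost of the fresh window — the past `[rootStep, h]` lies inside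
the old life and costs no more there (`renew_past`), the rest is the window `[h+1, h+1+W e)`. [folklore] -/
theorem lifeCost_renew_le (B : Banking adm W cost credit bank reserve ext) {G : Gen ε} {e : ε} {h : ℕ}
    (hA : adm (Gen.renew G e h)) (hW : (Gen.renew G e h).WF W) :
    lifeCost W cost (Gen.renew G e h) ≤
      lifeCost W cost G + ∑ n ∈ Finset.Ico (h + 1) (h + 1 + W e), cost (Gen.renew G e h) n := by
  have hW' := hW
  simp only [Gen.WF] at hW'
  obtain ⟨-, -, hh, hhr⟩ := hW'
  have h1 : G.rootStep ≤ h + 1 := by omega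
  have h2 : h + 1 ≤ h + 1 + W e := Nat.le_add_right _ _
  unfold lifeCost life
  rw [Gen.rootStep_renew, Gen.reach_renew,
    ← Finset.sum_Ico_consecutive _ h1 h2]
  have hpast : ∑ n ∈ Finset.Ico G.rootStep (h + 1), cost (Gen.renew G e h) n ≤
      ∑ n ∈ Finset.Ico G.rootStep (G.reach W), cost G n :=
    calc ∑ n ∈ Finset.Ico G.rootStep (h + 1), cost (Gen.renew G e h) n
        ≤ ∑ n ∈ Finset.Ico G.rootStep (h + 1), cost G n :=
          Finset.sum_le_sum fun n hn => B.renew_past G e h hA hW n (by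
            have := (Finset.mem_Ico.1 hn).2; omega)
      _ ≤ ∑ n ∈ Finset.Ico G.rootStep (G.reach W), cost G n :=
          Finset.sum_le_sum_of_subset_of_nonneg (Finset.Ico_subset_Ico_right (by omega))
            fun n _ _ => B.cost_nonneg G n
  linarith

/-- **THE BANKED INDUCTION (1.80⁺)** — `t4/T4-EST-U5c.md` §3 (R1) «κ_j(Z) ≥ [the (1.80) sum] + b_j(Z), by the SAME
induction» AS A THEOREM over the (ID) ledger: for every well-formed genealogy, the raw printed credits of its events pay
the control costs of its whole pending life AND the retained bank of every event AND the reserve of its root: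
`lifeCost + banks + reserve root ≤ credits`.  Structural induction = print's (1.83) (no event: inside a window),
first case p. 386 (renewal: `lifeCost_renew_le` + `renew`), second case (1.85)–(1.88) (merger: the partners' ledgers +
`merge_geom` + `merge_pay`, the two roots re-booked by `reserve_merge`) — with the slack of (1.88) KEPT as `bank`;
admissibility descends along the genealogy by `adm_renew` / `adm_merge` (v1.1). [folklore] -/
theorem banked_induction (B : Banking adm W cost credit bank reserve ext) :
    ∀ G : Gen ε, adm G → G.WF W → lifeCost W cost G + banks bank G + reserve G.root ≤ credits credit G
  | Gen.born b j, hA, _ => by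
      simpa [lifeCost, life, banks, credits] using B.born b j hA
  | Gen.renew G e h, hA, hW => by
      have hW' := hW
      simp only [Gen.WF] at hW'
      obtain ⟨hG, he, -, -⟩ := hW'
      have IH := banked_induction B G (B.adm_renew G e h hA) hG
      have hsplit := lifeCost_renew_le B hA hW
      have hpay := B.renew G e h hA hW
      have hb : banks bank (Gen.renew G e h) = bank e + banks bank G := by
        simp [banks, Finset.sum_insert he]
      rw [hb, credits_renew credit h he, root_renew]
      linarith
  | Gen.merge X Y e, hA, hW => by
      have hW' := hW
      simp only [Gen.WF] at hW'
      obtain ⟨hX, hY, heX, heY, hXY, -, -⟩ := hW'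
      have IHX := banked_induction B X (B.adm_merge X Y e hA).1 hX
      have IHY := banked_induction B Y (B.adm_merge X Y e hA).2 hY
      have hgeom := B.merge_geom X Y e hA hW
      have hpay := B.merge_pay X Y e hA hW
      have hres := reserve_merge reserve X Y e
      have he : e ∉ X.events ∪ Y.events := by simp [heX, heY]
      have hb : banks bank (Gen.merge X Y e) = bank e + (banks bank X + banks bank Y) := by
        simp [banks, Finset.sum_insert he, Finset.sum_union hXY]
      rw [hb, credits_merge credit heX heY hXY]
      linarith

/-- The same, read as NET PRINTED EXPONENT ≥ RETAINED BANK: `banks + reserve root ≤ credits − lifeCost`. [folklore] -/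
theorem banks_le_net (B : Banking adm W cost credit bank reserve ext) {G : Gen ε} (hA : adm G) (hG : G.WF W) :
    banks bank G + reserve G.root ≤ credits credit G - lifeCost W cost G := by
  have := banked_induction B G hA hG
  linarith

/-- Dropping the reserve (an upper bound needs only `0 ≤ reserve root`): `lifeCost + banks ≤ credits`. [folklore] -/
theorem lifeCost_add_banks_le (B : Banking adm W cost credit bank reserve ext) {G : Gen ε} (hA : adm G)
    (hG : G.WF W) (hr : 0 ≤ reserve G.root) : lifeCost W cost G + banks bank G ≤ credits credit G := by
  have := banked_induction B G hA hG
  linarith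

end Induction

/-! ## §3 Exponentiated: the structure's raw factor is below its records-currency price -/

section Price

variable {ε : Type*} [DecidableEq ε]
variable {adm : Gen ε → Prop} {W : ε → ℕ} {cost : Gen ε → ℕ → ℝ} {credit bank reserve : ε → ℝ}
  {ext : Gen ε → Gen ε → ε → ℝ}

/-- **RAW FACTOR ≤ e^{−(banks + reserve)}**: the product of the printed factors `e^{−credit}` of the events times the
accumulated control costs `e^{+lifeCost}` is at most `e^{−banks}·e^{−reserve root}`. [folklore] -/
theorem rawFactor_le (B : Banking adm W cost credit bank reserve ext) {G : Gen ε} (hA : adm G) (hG : G.WF W) :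
    Real.exp (-credits credit G) * Real.exp (lifeCost W cost G) ≤
      Real.exp (-banks bank G) * Real.exp (-reserve G.root) := by
  rw [← Real.exp_add, ← Real.exp_add, Real.exp_le_exp]
  have := banked_induction B G hA hG
  linarith

/-- With `bank e = κ₁·W e + E e` the bank factor of a genealogy is the product of the per-event currency factors
`e^{−κ₁W e}·e^{−E e}` over its events. [folklore] -/
theorem exp_neg_banks_eq (κ₁ : ℝ) (Wr E : ε → ℝ) (G : Gen ε) :
    Real.exp (-banks (fun e => κ₁ * Wr e + E e) G) =
      ∏ e ∈ G.events, (Real.exp (-(κ₁ * Wr e)) * Real.exp (-E e)) := by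
  unfold banks
  rw [← Finset.sum_neg_distrib, Real.exp_sum]
  refine Finset.prod_congr rfl fun e _ => ?_
  rw [← Real.exp_add]
  congr 1
  ring

/-- **THE RAW FACTOR IS BELOW THE RECORDS-CURRENCY PRICE** — the EXACT shape of the count carrier's price binder `hy`
(`…T4LiveStructureGas.exists_relWeightBound_of_recordsGas`, `…T4PersistentHistoryCount.slotPrice_le`:
`y ≤ ρ b · e^{−κ₁·W b} · ∏_{e ∈ Q} (e^{−κ₁·W e} · η e)`) for the structure described by a well-formed genealogy `G`, with
root birth `b = G.root`, record `Q = G.events.erase G.root` (the dictionary's, `Gen.mem_records`), birth price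
`ρ b = e^{−(reserve b + E b)}` and event weights `η e = e^{−E e}`: if the banks `κ₁·W e + E e` are retained (`Banking`),
then `e^{−credits}·e^{+lifeCost} ≤ ρ_root·e^{−κ₁W root}·∏_{e ∈ Q}(e^{−κ₁W e}·η_e)` for every ADMISSIBLE well-formed `G`.
(`W` enters the bank through any real-valued `Wr`, e.g. `Wr e = (W e : ℝ)`.) [folklore] -/
theorem rawFactor_le_recordPrice {κ₁ : ℝ} {Wr E : ε → ℝ}
    (B : Banking adm W cost credit (fun e => κ₁ * Wr e + E e) reserve ext) {G : Gen ε} (hA : adm G)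
    (hG : G.WF W) :
    Real.exp (-credits credit G) * Real.exp (lifeCost W cost G) ≤
      (Real.exp (-(reserve G.root + E G.root)) * Real.exp (-(κ₁ * Wr G.root))) *
        ∏ e ∈ G.events.erase G.root, (Real.exp (-(κ₁ * Wr e)) * Real.exp (-E e)) := by
  have h1 := rawFactor_le B hA hG
  rw [exp_neg_banks_eq, ← Finset.mul_prod_erase _ _ G.root_mem] at h1
  have h2 : (Real.exp (-(κ₁ * Wr G.root)) * Real.exp (-E G.root)) *
        (∏ e ∈ G.events.erase G.root, (Real.exp (-(κ₁ * Wr e)) * Real.exp (-E e))) *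
        Real.exp (-reserve G.root) =
      (Real.exp (-(reserve G.root + E G.root)) * Real.exp (-(κ₁ * Wr G.root))) *
        ∏ e ∈ G.events.erase G.root, (Real.exp (-(κ₁ * Wr e)) * Real.exp (-E e)) := by
    have : Real.exp (-(reserve G.root + E G.root)) = Real.exp (-reserve G.root) * Real.exp (-E G.root) := by
      rw [← Real.exp_add]; congr 1; ring
    rw [this]; ring
  linarith [h2]

end Price

/-! ## §4 The pay side of the binders from the typed flow, by name (non-vacuity on print's cost shapes) -/

section Pay

/-- Along the typed (2.7) (`B14.FlowIneq27`, first member) a LATER profile is below an earlier one up to `(1 + β₀)`: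
`p₀(g_n) ≤ (1 + β₀)·p₀(g_m)` for `m ≤ n ≤ K` — the printed factor of the surplus sentence p. 386 «hence 2p₀(g_{j(X)}) +
2p₀(g_{j(Y)}) − 2p₀(g_{j(Z)}) ≥ 2(1 + β₀)^{−1}p₀(g_{j+1})» (there `m = j(X) ≤ j + 1 = n`). [folklore] -/
theorem p0Profile_le_of_le {g : ℕ → ℝ} {β' β₀ A₀ : ℝ} {p₀ K : ℕ} (h27 : B14.FlowIneq27 g β' β₀ p₀ K)
    (hβ : 0 ≤ β₀) (hA : 0 ≤ A₀) {m n : ℕ} (hmn : m ≤ n) (hn : n ≤ K) (hxn : 0 ≤ Real.log ((g n) ^ 2)⁻¹) :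
    p0Profile A₀ p₀ (g n) ≤ (1 + β₀) * p0Profile A₀ p₀ (g m) := by
  unfold p0Profile
  rcases Nat.lt_or_ge m n with hlt | hge
  · have h := (h27 m n hlt hn).1
    calc A₀ * (Real.log ((g n) ^ 2)⁻¹) ^ p₀ ≤ A₀ * ((1 + β₀) * (Real.log ((g m) ^ 2)⁻¹) ^ p₀) :=
          mul_le_mul_of_nonneg_left h hA
      _ = (1 + β₀) * (A₀ * (Real.log ((g m) ^ 2)⁻¹) ^ p₀) := by ring
  · have hmn' : m = n := le_antisymm hmn hge
    subst hmn'
    have h0 : 0 ≤ A₀ * (Real.log ((g m) ^ 2)⁻¹) ^ p₀ := mul_nonneg hA (pow_nonneg hxn _)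
    nlinarith

/-- **THE MERGER SURPLUS PAYS** (the numeric content of `Banking.merge_pay` in print's shapes, `K`-uniform): under the
hypotheses of `…T4PersistentHistoryCount.credit_dominates_window_poly` with constants `(1 + β₀)·(c₁ + c₂) ≤ 2`, at every
merger step `s ≤ K` and for every absorbed root born at `m ≤ s`: extension cost `E₁·(R s)^q` + bank `κ₁·W s + E₀` is at
most the released reserve `2·p₀(g_m)`.  (Print keeps `2(1+β₀)^{−1}p₀(g_{j+1})` of it and spends «O(1)3(100M)^dR^{d+2}_{j+1}»;
R1 asks the p₀-largeness doubled so that a bank survives — both are the γ-clauses here.) [folklore] -/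
theorem mergeSurplus_pays {g : ℕ → ℝ} {R W : ℕ → ℕ} {β' β₀ A₀ c₁ c₂ F E₀ E₁ κ₁ : ℝ} {L p₀ r q K : ℕ}
    (h27 : B14.FlowIneq27 g β' β₀ p₀ K) (hR : ∀ s, s ≤ K → B14.IsRj L r (g s) (R s))
    (hrp : r ≤ p₀) (hrq : r * q ≤ p₀) (hL : 1 ≤ L) (hβ : 0 ≤ β₀) (hA : 0 ≤ A₀) (hc₁ : 0 ≤ c₁) (hc₂ : 0 ≤ c₂)
    (hE₀ : 0 ≤ E₀) (hκ : 0 ≤ κ₁)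
    (hx1 : ∀ s, s ≤ K → 1 ≤ Real.log ((g s) ^ 2)⁻¹)
    (hW : ∀ s, s ≤ K → (W s : ℝ) ≤ (1 + F) * R s)
    (hγ₁ : (L : ℝ) * (1 + β₀) * ((1 + F) * κ₁ + E₀) ≤ c₁ * A₀ * (Real.log ((g K) ^ 2)⁻¹) ^ (p₀ - r))
    (hγ₂ : (L : ℝ) ^ q * (1 + β₀) * E₁ ≤ c₂ * A₀ * (Real.log ((g K) ^ 2)⁻¹) ^ (p₀ - r * q))
    (hc : (1 + β₀) * (c₁ + c₂) ≤ 2) :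
    ∀ m s, m ≤ s → s ≤ K → E₁ * (R s : ℝ) ^ q + (κ₁ * W s + E₀) ≤ 2 * p0Profile A₀ p₀ (g m) := by
  intro m s hms hs
  have h1 := credit_dominates_window_poly h27 hR hrp hrq hL hβ hA hc₁ hc₂ hE₀ hκ hx1 hW hγ₁ hγ₂ s hs
  have h2 := p0Profile_le_of_le h27 hβ hA hms hs (by linarith [hx1 s hs])
  have hPm : 0 ≤ p0Profile A₀ p₀ (g m) := by
    unfold p0Profile; exact mul_nonneg hA (pow_nonneg (by linarith [hx1 m (hms.trans hs)]) _)
  have hcc : 0 ≤ c₁ + c₂ := add_nonneg hc₁ hc₂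
  calc E₁ * (R s : ℝ) ^ q + (κ₁ * W s + E₀) ≤ (c₁ + c₂) * p0Profile A₀ p₀ (g s) := by linarith
    _ ≤ (c₁ + c₂) * ((1 + β₀) * p0Profile A₀ p₀ (g m)) := mul_le_mul_of_nonneg_left h2 hcc
    _ = ((1 + β₀) * (c₁ + c₂)) * p0Profile A₀ p₀ (g m) := by ring
    _ ≤ 2 * p0Profile A₀ p₀ (g m) := mul_le_mul_of_nonneg_right hc hPm

/-- **THE RENEWAL FACTOR PAYS** (the numeric content of `Banking.renew` in print's shapes): a component ready at step
`h` is renewed with the factor «exp(−p₀(g_j))», `j = h`, and pays the window of the scale-`(h+1)` domain («K = R_{j+1} for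
Z» p. 386); under the same hypotheses with `(1 + β₀)·(c₁ + c₂) ≤ 1`: window cost `E₁·(R (h+1))^q` + bank
`κ₁·W (h+1) + E₀ ≤ p₀(g_h)` whenever `h + 1 ≤ K`. [folklore] -/
theorem renewalFactor_pays {g : ℕ → ℝ} {R W : ℕ → ℕ} {β' β₀ A₀ c₁ c₂ F E₀ E₁ κ₁ : ℝ} {L p₀ r q K : ℕ}
    (h27 : B14.FlowIneq27 g β' β₀ p₀ K) (hR : ∀ s, s ≤ K → B14.IsRj L r (g s) (R s))
    (hrp : r ≤ p₀) (hrq : r * q ≤ p₀) (hL : 1 ≤ L) (hβ : 0 ≤ β₀) (hA : 0 ≤ A₀) (hc₁ : 0 ≤ c₁) (hc₂ : 0 ≤ c₂)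
    (hE₀ : 0 ≤ E₀) (hκ : 0 ≤ κ₁)
    (hx1 : ∀ s, s ≤ K → 1 ≤ Real.log ((g s) ^ 2)⁻¹)
    (hW : ∀ s, s ≤ K → (W s : ℝ) ≤ (1 + F) * R s)
    (hγ₁ : (L : ℝ) * (1 + β₀) * ((1 + F) * κ₁ + E₀) ≤ c₁ * A₀ * (Real.log ((g K) ^ 2)⁻¹) ^ (p₀ - r))
    (hγ₂ : (L : ℝ) ^ q * (1 + β₀) * E₁ ≤ c₂ * A₀ * (Real.log ((g K) ^ 2)⁻¹) ^ (p₀ - r * q))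
    (hc : (1 + β₀) * (c₁ + c₂) ≤ 1) :
    ∀ h, h + 1 ≤ K → E₁ * (R (h + 1) : ℝ) ^ q + (κ₁ * W (h + 1) + E₀) ≤ p0Profile A₀ p₀ (g h) := by
  intro h hh
  have h1 := credit_dominates_window_poly h27 hR hrp hrq hL hβ hA hc₁ hc₂ hE₀ hκ hx1 hW hγ₁ hγ₂ (h + 1) hh
  have h2 := p0Profile_le_of_le h27 hβ hA (Nat.le_succ h) hh (by linarith [hx1 (h + 1) hh])
  have hPm : 0 ≤ p0Profile A₀ p₀ (g h) := by
    unfold p0Profile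
    exact mul_nonneg hA (pow_nonneg (by linarith [hx1 h ((Nat.le_succ h).trans hh)]) _)
  have hcc : 0 ≤ c₁ + c₂ := add_nonneg hc₁ hc₂
  calc E₁ * (R (h + 1) : ℝ) ^ q + (κ₁ * W (h + 1) + E₀) ≤ (c₁ + c₂) * p0Profile A₀ p₀ (g (h + 1)) := by linarith
    _ ≤ (c₁ + c₂) * ((1 + β₀) * p0Profile A₀ p₀ (g h)) := mul_le_mul_of_nonneg_left h2 hcc
    _ = ((1 + β₀) * (c₁ + c₂)) * p0Profile A₀ p₀ (g h) := by ring
    _ ≤ 1 * p0Profile A₀ p₀ (g h) := mul_le_mul_of_nonneg_right hc hPm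
    _ = p0Profile A₀ p₀ (g h) := one_mul _

/-- **THE BIRTH FACTOR PAYS** (the numeric content of `Banking.born` in print's shapes): the (1.79) exponent of a region of
fatness `d′` born at step `s`, `a·p₀²(g_s)·(d′+1) + 2p₀(g_s)`, pays a size-proportional epoch cost + bank
`(E_f + μ + E_b (R s)^q)(d′+1)` AND keeps the reserve `2p₀(g_s)` — `…T4PersistentHistoryCount.birthCredit_dominates`
with the reserve carried through. [folklore] -/
theorem birthFactor_pays {g : ℕ → ℝ} {R : ℕ → ℕ} {β' β₀ A₀ a c₃ E_f μ E_b : ℝ} {p₀ q K : ℕ}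
    (h27 : B14.FlowIneq27 g β' β₀ p₀ K) (hβ : 0 ≤ β₀) (hA : 0 ≤ A₀) (ha : 0 ≤ a)
    (hx0 : ∀ s, s ≤ K → 0 ≤ Real.log ((g s) ^ 2)⁻¹)
    (hpoly : ∀ s, s ≤ K → E_f + μ + E_b * (R s : ℝ) ^ q ≤ c₃ * p0Profile A₀ p₀ (g s))
    (hthr : (1 + β₀) * c₃ ≤ a * p0Profile A₀ p₀ (g K)) :
    ∀ s, s ≤ K → ∀ d' : ℕ,
      (E_f + μ + E_b * (R s : ℝ) ^ q) * ((d' : ℝ) + 1) + 2 * p0Profile A₀ p₀ (g s) ≤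
        a * (p0Profile A₀ p₀ (g s)) ^ 2 * ((d' : ℝ) + 1) + 2 * p0Profile A₀ p₀ (g s) := by
  intro s hs d'
  have := birthCredit_dominates h27 hβ hA ha hx0 hpoly hthr s hs d'
  linarith

end Pay

/-! ## §5 Non-vacuity: the flat model inhabits `Banking`; the theorem on the dictionary's sanity genealogy -/

section Flat

variable {ε : Type*} [DecidableEq ε]

/-- Every well-formed genealogy is born no later than it ends: `rootStep ≤ reach`. [folklore] -/
theorem rootStep_le_reach (W : ε → ℕ) : ∀ G : Gen ε, G.WF W → G.rootStep ≤ G.reach W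
  | Gen.born b j, _ => by simp
  | Gen.renew G e h, hW => by
      simp only [Gen.WF] at hW
      simp only [Gen.rootStep_renew, Gen.reach_renew]
      omega
  | Gen.merge X Y e, hW => by
      simp only [Gen.WF] at hW
      obtain ⟨hX, -, -, -, -, -, -⟩ := hW
      have := rootStep_le_reach W X hX
      simp only [Gen.rootStep_merge, Gen.reach_merge]
      omega

/-- **THE MERGED LIFE IS NO LONGER THAN THE TWO LIVES PLUS THE MERGER WINDOW** — because the partners' lives OVERLAP
(`Gen.WF`; in print both partners are domains of the same step `j + 1`, pp. 386–387 — the dictionary's reading, not a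
quotation [v1.1 DOCFIX D1]), the union `[min rootStep, max reach)` has no gap; this is the life-length content of the
cost split (1.88). [folklore] -/
theorem card_life_merge_le (W : ε → ℕ) {X Y : Gen ε} {e : ε} (hW : (Gen.merge X Y e).WF W) :
    (life W (Gen.merge X Y e)).card ≤ (life W X).card + (life W Y).card + W e := by
  have hW' := hW
  simp only [Gen.WF] at hW'
  obtain ⟨hX, hY, -, -, -, h1, h2⟩ := hW'
  have hx := rootStep_le_reach W X hX
  have hy := rootStep_le_reach W Y hY
  simp only [life, Nat.card_Ico, Gen.rootStep_merge, Gen.reach_merge]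
  omega

/-- **THE FLAT MODEL**: constant per-step cost `c ≥ 0`, every event credited exactly its own window cost plus its bank
plus its reserve (`reserve ≥ 0`), merger extension `c·W e`, no admissibility restriction (`adm := fun _ => True`, v1's
reading).  All four binders hold for ALL well-formed genealogies at once — `merge_geom` by `card_life_merge_le`,
`merge_pay` because the absorbed reserve is spare.  (It evades O1 only by crediting mergers; the print-shaped
inhabitation is `…T4PrintedShapeBanking`.) [folklore] -/
theorem Banking.flat (W : ε → ℕ) {c : ℝ} (hc : 0 ≤ c) (bank reserve : ε → ℝ) (hr : ∀ e, 0 ≤ reserve e) :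
    Banking (fun _ => True) W (fun _ _ => c) (fun e => c * W e + bank e + reserve e) bank reserve
      (fun _ _ e => c * W e) where
  cost_nonneg _ _ := hc
  adm_renew _ _ _ _ := trivial
  adm_merge _ _ _ _ := ⟨trivial, trivial⟩
  born b j _ := by
    simp only [Finset.sum_const, Nat.card_Ico, Nat.add_sub_cancel_left, nsmul_eq_mul]
    linarith [mul_comm (W b : ℝ) c]
  renew_past _ _ _ _ _ _ _ := le_rfl
  renew G e h _ _ := by
    simp only [Finset.sum_const, Nat.card_Ico, Nat.add_sub_cancel_left, nsmul_eq_mul]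
    linarith [mul_comm (W e : ℝ) c, hr e]
  merge_geom X Y e _ hW := by
    have h := card_life_merge_le W hW
    simp only [lifeCost, Finset.sum_const, nsmul_eq_mul]
    have h' : ((life W (Gen.merge X Y e)).card : ℝ) ≤ (life W X).card + (life W Y).card + W e := by
      exact_mod_cast h
    nlinarith
  merge_pay X Y e _ _ := by
    have := hr (absorbed X Y)
    have := hr e
    linarith

/-- The banked induction on the dictionary's sanity genealogy `G₀ = merge (born 0 0) (born 1 1) 2` (windows `3, 4, 2`,
reach `7`, root `0`) in the flat model with `c = 1`, banks `5` and reserves `2` per event: life cost `7`, banks `15`,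
root reserve `2`, credits `(3+5+2) + (4+5+2) + (2+5+2) = 30`, and indeed `7 + 15 + 2 ≤ 30` (the absorbed reserve `2` and
the merger's own reserve `2` are the spare `4`; the lives `[0,3)`, `[1,5)` overlap in `2` steps, so the flat
`merge_geom` is slack by `2` as well — total slack `6 = 30 − 24`). [folklore] -/
example : lifeCost W₀ (fun _ _ => (1 : ℝ)) G₀ + banks (fun _ => (5 : ℝ)) G₀ + (fun _ => (2 : ℝ)) G₀.root ≤
    credits (fun e => (1 : ℝ) * W₀ e + 5 + 2) G₀ :=
  banked_induction (Banking.flat W₀ zero_le_one (fun _ => 5) (fun _ => 2) fun _ => by norm_num) G₀ trivial G₀_wf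

/-- … and the numbers: life cost `7`, banks `15`, credits `30`. [folklore] -/
example : lifeCost W₀ (fun _ _ => (1 : ℝ)) G₀ = 7 ∧ banks (fun _ => (5 : ℝ)) G₀ = 15 ∧
    credits (fun e => (1 : ℝ) * W₀ e + 5 + 2) G₀ = 30 := by
  have hlife : life W₀ G₀ = Finset.range 7 := by decide
  have hev : G₀.events = {2, 0, 1} := by decide
  refine ⟨?_, ?_, ?_⟩
  · simp [lifeCost, hlife]
  · rw [banks, hev]; norm_num
  · rw [credits, hev]; simp [W₀]; norm_num

end Flat

end Literature.MathematicalPhysics.QuantumFieldTheory.Balaban1983to89.T4BankedInduction
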